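import Summits.NavierStokesRegularity.FluidComputer.PalasekTowerRegisterGlobal

/-!
# K48 kernel (Phase D): the UNIFORM RE-TIMING lever against the v2.2 pair K1Q/K2Q

Cell `ns-blowup`, seat `ns-blowup-refuter` (g9), K-check K48 of REGISTER v2.2
(`PalasekTowerRegisterQuiet.lean`, p409896). LABEL: refuter kernel certificate (negative lemma
MODULO `tao_unconditional_uniqueness_velocity_forced` =: hU). WHAT THIS IS NOT: not Navier–Stokes
evidence, not a refutation of K2Q as typed (no `¬ EpisodeInductionQ` is claimed), not a construction.

THE LEVER. `Schedule.Rigid` pins every readout GAP (`window_eq`) but not the ORIGIN `τ 0`: the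
uniform translate `S.shift E` (`τ k ↦ τ k + E`, `T ↦ T + E`, same datum, same force, same constants)
of a pinned rigid quiet schedule is again pinned, rigid and quiet (`Schedule.Pins.shift`,
`Schedule.Rigid.shift`, `Schedule.Quiet.shift`; quietness is what keeps `push_small` on the shifted
windows). Hence K2Q, which quantifies over ALL such schedules, also speaks about `S.shift E` — whose
stages are LATE READS of the SAME forced flow (same datum, same force; unique by hU).

THE THEOREM (`EpisodeInductionQ.isEmpty_stage_shift`). Given hU and K2Q, a realisation `W` of the
tower with `S`'s datum and force, a level `k ≥ 1` and a shift `E ≥ 0` with `W.T ≤ τ (k+1) + E`: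
the shifted schedule has NO registered level-`k` stage. (K2Q would extend it to a classical solution
on `[0, τ (k+1) + E] ⊇ [0, W.T]`, equal to `W.u` on `[0, W.T)` by hU, continuous on the compact box
`[0, W.T] × B̄(0, radius)` — which `W`'s own diverging floors forbid,
`Realisation.false_of_continuousOn_box`.) With `W` := the tower glued from K1Q's stage by K2Q itself
(`Realisation.ofEpisodes`) and `E := T - τ (k+1)` (= the tail `W_{k+1} = Σ_{j>k} window_j`, a fraction
`0.415, 0.349, 0.292, … → 0` of the level-`k` window on the wide rates): **K2Q forces its own tower to
be NON-PERSISTENT at every level** — for every `k ≥ 1` at least one of floor / ceiling / strain /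
core-ledger of the levels `j ≤ k` must FAIL when read `W_{k+1}` late (`Stage.ofLateRead` turns
persistence into the forbidden stage; `EpisodeInductionQ.not_persistent_tower`). K2Q thus asserts
robust AUTONOMOUS heredity over the whole quiet class AND knife-edge timing of its own witness at
relative resolution `W_{k+1}/window_k → 0`. Legal (knife-edge towers are not excluded by the typing),
so this is a NEGATIVE LEMMA modulo hU plus a persistence rider, not `¬ K2Q`.

ONE-CLAUSE REPAIR (ADOPTED — REGISTER v2.3′ `PalasekTowerRegisterGlobal`, p411629, planner RULINGS
K48/K49): the GLOBAL level-0 ANCHOR `Schedule.AnchorGlobal S u := ∀ t ∈ [0, τ 0), ∀ x, ‖u t x‖ < c₁ Y₀`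
conjoined into the registered margin (`Margins.routeG`): the floor of any stage of `S` at `τ 0` violates
the anchor of `S.shift E`, `E > 0` (`Schedule.AnchorGlobal.not_shift`; pointwise and `hU`-free in the
tree as `Stage.τ_zero_le_of_anchorGlobal`), so with hU the K2 hypothesis over every proper translate of a
schedule carrying a stage is EMPTY (`Stage.isEmpty_routeG_shift`, companion file `ShiftStageAnchor.lean` §6–§7) and
`EpisodeInductionG` no longer speaks about late reads. K2R ⊇ K2Q (`EpisodeInductionQ.of_episodeInductionR`) inherits §3–§5; the A pair is
downstream of neither (`EpisodeInductionG.of_episodeInductionQ` goes the other way).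

References: S. Palasek, arXiv:2605.13827 §3.3–§4 [cite: Palasek2026ElementaryModel, §3.3];
T. Tao, Anal. PDE 6 (2013), Cor. 11.4 [cite: Tao2011, Cor. 11.4].
-/

noncomputable section

namespace Summit.NavierStokesRegularity.FluidComputer.PalasekTowerClayBridge

open Set MeasureTheory Filter Topology Function
open scoped ENNReal ContDiff NNReal
open Literature.Analysis.FluidPDE
open Summit.NavierStokesRegularity.NavierStokesRegularity

/-! ## §1 The uniform translate of a quiet schedule -/

namespace Schedule

variable {R : TowerRates} (S : Schedule R)

/-- **The uniform re-timing `S.shift E`** of a QUIET schedule: all readout times and the blow-up time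
translated by `E ≥ 0`; datum, force, constants, ball, loops unchanged. `push_small` on the shifted
window `[τ k + E, τ (k+1) + E]` holds because up to `τ (k+1)` it is `S`'s own bound and after
`τ (k+1) ≥ τ 1` the force is zero (quietness); `force_silent` from `T + E ≥ T`; the clock is
translation invariant. [cite: Palasek2026ElementaryModel, §3.3] -/
def shift (hQ : S.Quiet) {E : ℝ} (hE : 0 ≤ E) : Schedule R where
  T := S.T + E
  τ := fun k => S.τ k + E
  τ_zero_pos := add_pos_of_pos_of_nonneg S.τ_zero_pos hE
  τ_lt_succ := fun k => by
    have h := S.τ_lt_succ k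
    linarith
  τ_lt_T := fun k => by
    have h := S.τ_lt_T k
    linarith
  c₁ := S.c₁
  c₂ := S.c₂
  c₃ := S.c₃
  c₄ := S.c₄
  c₅ := S.c₅
  c₁_pos := S.c₁_pos
  c₄_le := S.c₄_le
  c₅_le := S.c₅_le
  gap := S.gap
  radius := S.radius
  clock := fun k => by
    have h := S.clock k
    linarith
  u₀ := S.u₀
  datum_decay := S.datum_decay
  f := S.f
  force_smooth := S.force_smooth
  force_decay := S.force_decay
  force_silent := fun t ht x => S.force_silent t (by linarith) x
  push_small := by
    intro k t ht x
    by_cases htk : t ≤ S.τ (k + 1)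
    · exact S.push_small k t ⟨by linarith [ht.1], htk⟩ x
    · have h1 : S.τ 1 ≤ t :=
        (S.τ_mono (Nat.le_add_left 1 k)).trans (le_of_lt (not_le.1 htk))
      rw [hQ.apply h1 x, norm_zero]
      exact mul_nonneg S.c₄_nonneg (Real.rpow_nonneg (R.N_pos k).le _)
  loop := S.loop
  loop_smooth := S.loop_smooth
  loop_closed := S.loop_closed
  Φ := S.Φ
  Φ_pos := S.Φ_pos

variable {S} (hQ : S.Quiet) {E : ℝ} (hE : 0 ≤ E)

/-- The translate keeps `T` (up to the shift `E` for times). [folklore] -/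
@[simp] theorem shift_T : (S.shift hQ hE).T = S.T + E := rfl
/-- The translate keeps `τ` (up to the shift `E` for times). [folklore] -/
@[simp] theorem shift_τ (k : ℕ) : (S.shift hQ hE).τ k = S.τ k + E := rfl
/-- The translate keeps `f` (up to the shift `E` for times). [folklore] -/
@[simp] theorem shift_f : (S.shift hQ hE).f = S.f := rfl
/-- The translate keeps `u₀` (up to the shift `E` for times). [folklore] -/
@[simp] theorem shift_u₀ : (S.shift hQ hE).u₀ = S.u₀ := rfl
/-- The translate keeps `radius` (up to the shift `E` for times). [folklore] -/
@[simp] theorem shift_radius : (S.shift hQ hE).radius = S.radius := rfl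
/-- The translate keeps `c₁` (up to the shift `E` for times). [folklore] -/
@[simp] theorem shift_c₁ : (S.shift hQ hE).c₁ = S.c₁ := rfl
/-- The translate keeps `c₂` (up to the shift `E` for times). [folklore] -/
@[simp] theorem shift_c₂ : (S.shift hQ hE).c₂ = S.c₂ := rfl
/-- The translate keeps `c₃` (up to the shift `E` for times). [folklore] -/
@[simp] theorem shift_c₃ : (S.shift hQ hE).c₃ = S.c₃ := rfl
/-- The translate keeps `c₄` (up to the shift `E` for times). [folklore] -/
@[simp] theorem shift_c₄ : (S.shift hQ hE).c₄ = S.c₄ := rfl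
/-- The translate keeps `c₅` (up to the shift `E` for times). [folklore] -/
@[simp] theorem shift_c₅ : (S.shift hQ hE).c₅ = S.c₅ := rfl

/-- The pins are translation invariant (they see only gaps, constants, datum and force). [folklore] -/
theorem Pins.shift {Λ θ : ℝ} (h : S.Pins Λ θ) : (S.shift hQ hE).Pins Λ θ where
  impulse := fun k => by
    have h1 := h.impulse k
    simp only [shift_τ, shift_c₁, shift_c₂, shift_c₄]
    linarith
  sep := h.sep
  datum_confined := h.datum_confined
  force_confined := h.force_confined

/-- **Rigidity does not pin the origin**: the uniform translate of a rigid schedule is rigid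
(window equality sees only gaps). [folklore] -/
theorem Rigid.shift (h : S.Rigid) : (S.shift hQ hE).Rigid where
  window_eq := fun k => by
    have h1 := h.window_eq k
    simp only [shift_τ, shift_c₅]
    linarith
  c₅_eq := h.c₅_eq
  c₁_eq := h.c₁_eq
  c₂_eq := h.c₂_eq

/-- Quietness is inherited by forward translates (`τ 1 ≤ τ 1 + E`). [folklore] -/
theorem Quiet.shift : (S.shift hQ hE).Quiet := fun t ht => hQ t (by simp only [shift_τ] at ht; linarith)

end Schedule

/-! ## §2 On a rigid schedule `quiet` is `ceiling` (N2′ of K48) -/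

/-- Window equality makes the invisibility endpoint of level `j+1` the readout `τ j`. [folklore] -/
theorem Schedule.Rigid.quiet_endpoint {R : TowerRates} {S : Schedule R} (h : S.Rigid) (j : ℕ) :
    S.τ (j + 1) - S.c₅ * Real.log (R.N (j + 1)) / R.A j = S.τ j := by
  have := h.window_eq j
  linarith

/-- Hence on a rigid schedule the `quiet` field of a stage follows from its `ceiling` field. [folklore] -/
theorem Schedule.Rigid.quiet_of_ceiling {R : TowerRates} {S : Schedule R} (h : S.Rigid) {k : ℕ}
    {u : ℝ → EuclideanSpace ℝ (Fin 3) → EuclideanSpace ℝ (Fin 3)}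
    (hce : ∀ j, j ≤ k → ∀ t ∈ Icc 0 (S.τ j), ∀ x, ‖u t x‖ ≤ S.c₂ * R.Y j) :
    ∀ j, j + 1 ≤ k → ∀ t ∈ Icc 0 (S.τ (j + 1) - S.c₅ * Real.log (R.N (j + 1)) / R.A j),
      ∀ x, ‖u t x‖ ≤ S.c₂ * R.Y j := by
  intro j hj t ht x
  rw [h.quiet_endpoint j] at ht
  exact hce j (by omega) t ht x

/-! ## §3 THE LEVER: K2Q + hU forbid registered stages of late translates -/

/-- **No registered stage of a late translate.** Given hU and K2Q, a realisation `W` with `S`'s datum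
and force, `k ≥ 1`, `E ≥ 0` with `W.T ≤ τ (k+1) + E`: the translate `S.shift E` has no registered
level-`k` stage — K2Q would extend it past `W.T`, uniqueness glues it to `W` on `[0, W.T)`, and a
field continuous on `[0, W.T] × B̄(0, radius)` cannot carry `W`'s diverging floors.
[cite: Tao2011, Cor. 11.4] -/
theorem EpisodeInductionQ.isEmpty_stage_shift (h₂ : EpisodeInductionQ)
    (hU : tao_unconditional_uniqueness_velocity_forced)
    {S : Schedule TowerRates.wide} (hP : S.Pins 8 (6 / 5)) (hR : S.Rigid) (hQ : S.Quiet)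
    (W : Realisation 1 TowerRates.wide) (hWf : W.f = S.f) (hW0 : W.u 0 = S.u₀)
    {k : ℕ} (hk : 1 ≤ k) {E : ℝ} (hE : 0 ≤ E) (hT : W.T ≤ S.τ (k + 1) + E) :
    IsEmpty (Stage 1 TowerRates.wide (S.shift hQ hE)
      (Margins.withStrain (Margins.register TowerRates.wide)) k) := by
  refine ⟨fun sE => ?_⟩
  obtain ⟨s', -⟩ := h₂ (S.shift hQ hE) (hP.shift hQ hE) (hR.shift hQ hE)
    (Schedule.Quiet.shift hQ hE) k hk sE
  -- the extension is classical on `[0, τ (k+1) + E] ⊇ [0, W.T]` with `S`'s force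
  have hcl : IsClassicalNSSolutionOn (Icc 0 (S.τ (k + 1) + E)) 1 S.f s'.u s'.p := s'.classical
  have hWcl : IsClassicalNSSolutionOn (Ico 0 W.T) 1 S.f W.u W.p := hWf ▸ W.classical
  -- agreement with the tower on `[0, W.T)` by hU on each closed slab `[0, t]`
  have heq : ∀ t ∈ Ico 0 W.T, s'.u t = W.u t := by
    intro t ht
    rcases ht.1.eq_or_lt with h00 | ht0
    · rw [← h00, s'.initial, hW0]
      rfl
    · have hs't : IsClassicalNSSolutionOn (Icc 0 t) 1 S.f s'.u s'.p :=
        hcl.mono (Icc_subset_Icc le_rfl (ht.2.le.trans hT)) (uniqueDiffOn_Icc ht0)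
      have hWt : IsClassicalNSSolutionOn (Icc 0 t) 1 S.f W.u W.p :=
        hWcl.mono (fun _ hs => ⟨hs.1, lt_of_le_of_lt hs.2 ht.2⟩) (uniqueDiffOn_Icc ht0)
      have hC1 : ContDiff ℝ 1 (W.u 0) := W.contDiff_datum.of_le (by norm_cast)
      obtain ⟨hL2, hH1⟩ := Theorems.ClayUniqueness.memLp_two_of_rapidDecay W.datum_decay hC1
      have hEs : ∃ C : ℝ≥0∞, C < ⊤ ∧ ∀ s ∈ Icc 0 t, ∫⁻ x, ‖s'.u s x‖ₑ ^ 2 ≤ C := by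
        obtain ⟨C, hC, hb⟩ := s'.energy
        exact ⟨C, hC, fun s hs => hb s ⟨hs.1, hs.2.trans (ht.2.le.trans hT)⟩⟩
      have hEW : ∃ C : ℝ≥0∞, C < ⊤ ∧ ∀ s ∈ Icc 0 t, ∫⁻ x, ‖W.u s x‖ₑ ^ 2 ≤ C := W.energy t ht.2
      have h0 : s'.u 0 = W.u 0 := by rw [s'.initial, hW0]; rfl
      exact hU 1 t one_pos ht0 (W.u 0) hL2 hH1 S.f S.force_smooth S.force_decay s'.u W.u s'.p W.p
        hs't hWt h0 rfl hEs hEW t ⟨ht.1, le_rfl⟩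
  -- continuity on the compact box, forbidden by the floors
  have hcont : ContinuousOn (uncurry s'.u)
      (Icc (0 : ℝ) W.T ×ˢ Metric.closedBall (0 : EuclideanSpace ℝ (Fin 3)) W.radius) :=
    (ContDiffOn.continuousOn s'.classical.smooth_velocity).mono
      (prod_mono (fun _ hs => ⟨hs.1, hs.2.trans hT⟩) (subset_univ _))
  exact W.false_of_continuousOn_box hcont heq

/-- The same over the v2.1 class (K2R ⊇ K2Q). [cite: Tao2011, Cor. 11.4] -/
theorem EpisodeInductionR.isEmpty_stage_shift (h₂ : EpisodeInductionR)
    (hU : tao_unconditional_uniqueness_velocity_forced)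
    {S : Schedule TowerRates.wide} (hP : S.Pins 8 (6 / 5)) (hR : S.Rigid) (hQ : S.Quiet)
    (W : Realisation 1 TowerRates.wide) (hWf : W.f = S.f) (hW0 : W.u 0 = S.u₀)
    {k : ℕ} (hk : 1 ≤ k) {E : ℝ} (hE : 0 ≤ E) (hT : W.T ≤ S.τ (k + 1) + E) :
    IsEmpty (Stage 1 TowerRates.wide (S.shift hQ hE)
      (Margins.withStrain (Margins.register TowerRates.wide)) k) :=
  (EpisodeInductionQ.of_episodeInductionR h₂).isEmpty_stage_shift hU hP hR hQ W hWf hW0 hk hE hT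

/-! ## §4 The tower of K1Q ∧ K2Q itself, read late -/

section Tower

variable {ν : ℝ} {R : TowerRates} {m : Margins R} (S : Schedule R) (s₁ : Stage ν R S m 1)
  (step : ∀ n, ∀ s : Stage ν R S m (n + 1), ∃ s' : Stage ν R S m (n + 1 + 1), s.Extends s')

/-- The glued tower has the schedule's blow-up time. [folklore] -/
theorem Realisation.ofEpisodes_T : (Realisation.ofEpisodes S s₁ step).T = S.T := rfl

/-- The glued tower has the schedule's force. [folklore] -/
theorem Realisation.ofEpisodes_f : (Realisation.ofEpisodes S s₁ step).f = S.f := rfl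

/-- The glued tower has the schedule's datum. [folklore] -/
theorem Realisation.ofEpisodes_u_zero : (Realisation.ofEpisodes S s₁ step).u 0 = S.u₀ := by
  show (Assembly.chain s₁ step _).u 0 = S.u₀
  exact (Assembly.chain s₁ step _).initial

end Tower

/-- **K2Q's own tower admits no registered LATE READ.** For the quiet pinned rigid schedule `S` of
K1Q with its level-1 stage `s₁`, and every `k ≥ 1`: the translate of `S` by the tail
`E_k := T - τ (k+1)` (`= Σ_{j>k} window_j`) has no registered level-`k` stage (given hU).
[cite: Tao2011, Cor. 11.4] -/
theorem EpisodeInductionQ.isEmpty_stage_tail_shift (h₂ : EpisodeInductionQ)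
    (hU : tao_unconditional_uniqueness_velocity_forced)
    {S : Schedule TowerRates.wide} (hP : S.Pins 8 (6 / 5)) (hR : S.Rigid) (hQ : S.Quiet)
    (s₁ : Stage 1 TowerRates.wide S (Margins.withStrain (Margins.register TowerRates.wide)) 1)
    {k : ℕ} (hk : 1 ≤ k) :
    IsEmpty (Stage 1 TowerRates.wide (S.shift hQ (sub_nonneg.2 (S.τ_lt_T (k + 1)).le))
      (Margins.withStrain (Margins.register TowerRates.wide)) k) :=
  h₂.isEmpty_stage_shift hU hP hR hQ
    (Realisation.ofEpisodes S s₁ (fun n s => h₂ S hP hR hQ (n + 1) (by omega) s))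
    (Realisation.ofEpisodes_f _ _ _) (Realisation.ofEpisodes_u_zero _ _ _) hk _
    (by rw [Realisation.ofEpisodes_T]; linarith)

/-! ## §5 Persistence ⇒ the forbidden stage -/

/-- **A late read of a realisation is a registered stage of the translate — if the margins persist.**
`W` a realisation with `S`'s datum and force, `S` rigid and quiet, `E ≥ 0`, `τ k + E < W.T`; if the
floors, ceilings and strain floors of the levels `j ≤ k` hold for `W.u` at the SHIFTED readouts
`τ j + E` (ceilings on `[0, τ j + E]`) and the core ledger holds at the shifted readouts, then
`W` restricted to `[0, τ k + E]` is a registered level-`k` stage of `S.shift E` (classical, datum,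
energy come from `W`; `quiet` from the ceilings by rigidity; `Rigid` is inherited). [folklore] -/
def Stage.ofLateRead {ν : ℝ} {R : TowerRates} (W : Realisation ν R) {S : Schedule R}
    (hR : S.Rigid) (hQ : S.Quiet) {E : ℝ} (hE : 0 ≤ E) (k : ℕ)
    (hWf : W.f = S.f) (hW0 : W.u 0 = S.u₀) (hkT : S.τ k + E < W.T)
    (hfloor : ∀ j, j ≤ k → ∃ x, ‖x‖ ≤ S.radius ∧ S.c₁ * R.Y j ≤ ‖W.u (S.τ j + E) x‖)
    (hceil : ∀ j, j ≤ k → ∀ t ∈ Icc 0 (S.τ j + E), ∀ x, ‖W.u t x‖ ≤ S.c₂ * R.Y j)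
    (hstrain : ∀ j, j ≤ k → ∃ x, ‖x‖ ≤ S.radius ∧ S.c₁ * R.A j ≤ ‖fderiv ℝ (W.u (S.τ j + E)) x‖)
    (hledger : CoreLedger R (S.shift hQ hE) k W.u) :
    Stage ν R (S.shift hQ hE) (Margins.withStrain (Margins.register R)) k where
  u := W.u
  p := W.p
  classical :=
    (hWf ▸ W.classical).mono (fun _ hs => ⟨hs.1, lt_of_le_of_lt hs.2 hkT⟩)
      (uniqueDiffOn_Icc (add_pos_of_pos_of_nonneg (S.τ_pos k) hE))
  initial := hW0
  energy := W.energy _ hkT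
  floor := hfloor
  ceiling := hceil
  quiet := (hR.shift hQ hE).quiet_of_ceiling hceil
  margin := ⟨hstrain, hR.shift hQ hE, hledger⟩

/-- **K2Q ⇒ its realisations are not persistent** (given hU). If `W` realises the tower with the
datum and force of a quiet pinned rigid `S`, `k ≥ 1` and `τ (k+1) < W.T`, then at the late-read shift
`E := W.T - τ (k+1)` NOT all of: floors / ceilings / strain floors of the levels `j ≤ k` at the
shifted readouts and the shifted core ledger, can hold. [cite: Tao2011, Cor. 11.4] -/
theorem EpisodeInductionQ.not_persistent (h₂ : EpisodeInductionQ)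
    (hU : tao_unconditional_uniqueness_velocity_forced)
    {S : Schedule TowerRates.wide} (hP : S.Pins 8 (6 / 5)) (hR : S.Rigid) (hQ : S.Quiet)
    (W : Realisation 1 TowerRates.wide) (hWf : W.f = S.f) (hW0 : W.u 0 = S.u₀)
    {k : ℕ} (hk : 1 ≤ k) (hkT : S.τ (k + 1) < W.T)
    (hfloor : ∀ j, j ≤ k → ∃ x, ‖x‖ ≤ S.radius ∧
      S.c₁ * TowerRates.wide.Y j ≤ ‖W.u (S.τ j + (W.T - S.τ (k + 1))) x‖)
    (hceil : ∀ j, j ≤ k → ∀ t ∈ Icc 0 (S.τ j + (W.T - S.τ (k + 1))), ∀ x,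
      ‖W.u t x‖ ≤ S.c₂ * TowerRates.wide.Y j)
    (hstrain : ∀ j, j ≤ k → ∃ x, ‖x‖ ≤ S.radius ∧
      S.c₁ * TowerRates.wide.A j ≤ ‖fderiv ℝ (W.u (S.τ j + (W.T - S.τ (k + 1)))) x‖)
    (hledger : CoreLedger TowerRates.wide (S.shift hQ (sub_nonneg.2 hkT.le)) k W.u) : False := by
  have hE : 0 ≤ W.T - S.τ (k + 1) := sub_nonneg.2 hkT.le
  have hkT' : S.τ k + (W.T - S.τ (k + 1)) < W.T := by linarith [S.τ_lt_succ k]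
  exact (h₂.isEmpty_stage_shift hU hP hR hQ W hWf hW0 hk hE (by linarith)).false
    (Stage.ofLateRead W hR hQ hE k hWf hW0 hkT' hfloor hceil hstrain hledger)

/-- **The internal form: K1Q's schedule, K2Q's tower.** For the tower glued from `s₁` by K2Q and every
`k ≥ 1`, persistence of the level-`≤ k` margins over the tail `E_k = T - τ (k+1)` is impossible
(given hU): K2Q asserts knife-edge timing of its own witness at every level. [cite: Tao2011, Cor. 11.4] -/
theorem EpisodeInductionQ.not_persistent_tower (h₂ : EpisodeInductionQ)
    (hU : tao_unconditional_uniqueness_velocity_forced)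
    {S : Schedule TowerRates.wide} (hP : S.Pins 8 (6 / 5)) (hR : S.Rigid) (hQ : S.Quiet)
    (s₁ : Stage 1 TowerRates.wide S (Margins.withStrain (Margins.register TowerRates.wide)) 1)
    {k : ℕ} (hk : 1 ≤ k) :
    let W := Realisation.ofEpisodes S s₁ (fun n s => h₂ S hP hR hQ (n + 1) (by omega) s)
    ¬ ((∀ j, j ≤ k → ∃ x, ‖x‖ ≤ S.radius ∧
          S.c₁ * TowerRates.wide.Y j ≤ ‖W.u (S.τ j + (S.T - S.τ (k + 1))) x‖) ∧
       (∀ j, j ≤ k → ∀ t ∈ Icc 0 (S.τ j + (S.T - S.τ (k + 1))), ∀ x,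
          ‖W.u t x‖ ≤ S.c₂ * TowerRates.wide.Y j) ∧
       (∀ j, j ≤ k → ∃ x, ‖x‖ ≤ S.radius ∧
          S.c₁ * TowerRates.wide.A j ≤ ‖fderiv ℝ (W.u (S.τ j + (S.T - S.τ (k + 1)))) x‖) ∧
       CoreLedger TowerRates.wide (S.shift hQ (sub_nonneg.2 (S.τ_lt_T (k + 1)).le)) k W.u) := by
  intro W ⟨hfloor, hceil, hstrain, hledger⟩
  exact h₂.not_persistent hU hP hR hQ W (Realisation.ofEpisodes_f _ _ _)
    (Realisation.ofEpisodes_u_zero _ _ _) hk (S.τ_lt_T (k + 1)) hfloor hceil hstrain hledger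

end Summit.NavierStokesRegularity.FluidComputer.PalasekTowerClayBridge

end
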